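import Summits.BirchSwinnertonDyer.BirchSwinnertonDyer.Theorems.ByReductionTypeAtTwoMultTowerNS2OrderCount
import Summits.BirchSwinnertonDyer.BirchSwinnertonDyer.Theorems.ByReductionTypeAtTwoMultTowerNS2TwoBit
import Literature.NumberTheory.EllipticCurves.Greenberg1999.ControlLocalKernelAtPMultiplicative
import HarnessLib

/-!
# Route `ByReductionTypeAtTwo`, crux `MultUpperHalfAtTwo` (item stmt-BirchSwinnertonDyer-19922), TOWER road, NON-SPLIT rows:
# the ORDER of the local tower kernel at a non-split multiplicative `2`, part 3 — `#𝒦_{v,n}[2^∞] ≤ 4` at EVERY layer,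
# and the PRINT binder `hNS2 = Greenberg1999.sec3_natCard_localTowerKerPrimary_le_four_nonsplitMultiplicative_two` PROVED

HONEST FRAMING (cell `bsd-2adic`, run/shared/lean/pub/bsd-2adic/, seat `bsd-2adic-tower-1` GEN 27, HUMAN RULINGS
D-0036 / D-0054 / D-0074): theorems only (no definition, no named fact, no `sorry`); closes no item by itself; nothing
booked; BSD is not proved by any of this. The NON-SPLIT tower doors of item 19922 (`MultTowerCert.towerGapAtTwo_of_layerSelmer_cert_nonsplitTwo`
and kin, ≈ 1 100 `…MultTowerClass*` files) display the PRINT binder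
`hNS2 : Greenberg1999.sec3_natCard_localTowerKerPrimary_le_four_nonsplitMultiplicative_two` (Greenberg, LNM 1716, §3
p. 93: at a NON-SPLIT multiplicative `v ∣ 2`, `|ker(r_{v_n})| ∼ 2c_v ≤ 4`; over `ℚ` the curve stays non-split over every
layer `(ℚ_n)_{v_n}` since `ℚ₂^cyc/ℚ₂` is totally ramified). GEN 9/10 of this seat proved its `2`-TORSION projection
(`localTowerKerTwoTorsion_le_two_nonsplitTwo_of_tateUnit_holds`, `twoTorsion_localTowerKerPrimary_le_four_nonsplitTwo`).
THIS FILE PROVES THE NAMED FACT ITSELF: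

* `powTorsion_localTowerKerPrimary_le_four_nonsplitTwo` — **`#𝒦_{v,n}[2^∞][2^k] ≤ 4` for every `k`**: GEN 10's assembly
  run on `2^k`-torsion coinvariant classes (BRICK 11 at `m = 2^k`; Tate's twisted uniformisation BRICK 18; among five
  `2^k`-torsion classes two coincide, part 2 `exists_div_eq_zpow_mul_coboundary_of_five_pow`, whose one non-formal input is
  C3 at exponent `2^k`, part 1: `x^{2^k} ∈ B ⇒ N_{R+k}(x) = N_R(x)^{2^k} = 1 ⇒` cyclic Hilbert 90);
* `finite_and_natCard_le_of_forall_torsionBy_pow` — pure algebra: a `p`-primary group all of whose `p^k`-torsion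
  subgroups have at most `C` elements has at most `C` elements;
* `finite_and_natCard_localTowerKerPrimary_le_four_nonsplitTwo` — **`𝒦_{v,n}[2^∞]` is finite of order `≤ 4`** for
  every globally minimal `W/ℚ` multiplicative NON-SPLIT at `2`, every cyclotomic `κ`, the place `v ∋ 2`, every layer `n`;
* `sec3_natCard_localTowerKerPrimary_le_four_nonsplitMultiplicative_two_holds` — **the named fact, PROVED** (signature
  verbatim); consumers keep `(hNS2 : …)` and may now pass this term.

Mathematics (Greenberg p. 93 made explicit; cell memos SCOPE-hNS2one-kernel-GEN8.md S3–S6, NOTE-NS2-GALOIS-ACTION-GEN14.md):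
`𝒦_{v,n} ≅ H¹(⟨g⟩, E(ℚ_{2,∞})) ↪ (M_∞/(g−1)M_∞)[2^∞]`, `M_∞ = Ψ(T)`, `T/Q^ℤ` the twisted Tate module over `F_∞K₂`
(`K₂ = ℚ₂(t)` the unramified quadratic field, `t² = −c₄/c₆`-normalised `γ`); the exponent `a(x)` (`τ₀x·x = Q^{a(x)}`) gives
`(M_∞/(g−1))[2^∞]/(unit-exponent classes) ↪ ℤ/2`, and the unit-exponent `2^k`-torsion classes are coboundaries `gy/y` whose
norms `y·τ₀y ∈ F_nˣ` are well defined modulo `N(F_nK₂ˣ)`, a subgroup of index `2` (the class field axiom for the unramified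
quadratic layer, BRICK 17) — so at most `2 · 2 = 4` classes. The bound is SHARP (`(ℤ/2)²` for Tate unit `≡ ±1 (mod 8)`,
`ℤ/4` for `≡ ±3 (mod 8)`, n ≥ 1; GEN 14's note).

References: R. Greenberg, LNM 1716 (1999), §3 pp. 85–93 (p. 93 «`|ker(r_v)| ∼ 2c_v`»); J. Silverman, GTM 151, V.3–V.5,
and AEC C.15 (`c_v ∈ {1,2}` non-split); J. Neukirch, *ANT* IV (3.5), V (1.1).
-/

set_option autoImplicit false
-- the Theorems namespace of this sub repeats the summit name by design (D-0017 nested layout: Summit.<S>.<Sub>)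
set_option linter.dupNamespace false

noncomputable section

open scoped Classical IntermediateField

namespace Summit.BirchSwinnertonDyer.BirchSwinnertonDyer.Theorems.MultTowerNS2

open NumberField IsDedekindDomain Field WeierstrassCurve PadicInt Rat.HeightOneSpectrum
  Literature.NumberTheory.EllipticCurves Literature.NumberTheory.EllipticCurves.ResKernel
  Literature.NumberTheory.GaloisRepresentations

variable {κ : ZpExtension ℚ 2}

/-! ### The assembly at exponent `2^k`: `#𝒦_{v,n}[2^∞][2^k] ≤ 4` at every non-split `2` -/

/-- **`#𝒦_{v,n}[2^∞][2^k] ≤ 4` at EVERY non-split multiplicative `2`, every `k` — KERNEL theorem.** For a globally minimal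
`W/ℚ`, multiplicative and NON-SPLIT at `2`, every cyclotomic `ℤ₂`-datum `κ`, the place `v ∋ 2`, every layer `n` and every
`k`, the `2^k`-torsion of the local tower kernel `𝒦_{v,n}[2^∞]` is finite of order at most `4`. Proof: BRICK 11 (at
`m = 2^k`) embeds it into the `2^k`-torsion of `M_∞/(g−1)M_∞`; Tate's twisted uniformisation identifies `M_∞` with `Ψ(T)`
(BRICK 18); `exists_div_eq_zpow_mul_coboundary_of_five_pow` (with BRICK 17 for the quadratic class field input, BRICK 10
for the flip, BRICK 15 for the generator) shows that among any five `2^k`-torsion classes two coincide. The case `k = 1` is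
GEN 10's `twoTorsion_localTowerKerPrimary_le_four_nonsplitTwo`. [cite: GreenbergLNM1716, §3 (pp. 85–93)]
[cite: SilvermanATAEC1994, Thm. V.5.3, Lemma V.5.2 (c)] [cite: NeukirchANT1999, Ch. V §1 Thm. (1.1)] -/
theorem powTorsion_localTowerKerPrimary_le_four_nonsplitTwo (W : WeierstrassCurve ℚ) [W.IsElliptic] [W.IsGloballyMinimal]
    (hmult : W.HasMultiplicativeReductionAtPrime 2) (hns : ¬ W.HasSplitMultiplicativeReductionAtPrime 2)
    (hκ : κ.IsCyclotomic) (v : HeightOneSpectrum (𝓞 ℚ)) (hv : ((2 : ℕ) : 𝓞 ℚ) ∈ v.asIdeal) (n k : ℕ) :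
    Finite {x : W.localTowerKerPrimary κ (v.adicCompletion ℚ) n // 2 ^ k • x = 0} ∧
      Nat.card {x : W.localTowerKerPrimary κ (v.adicCompletion ℚ) n // 2 ^ k • x = 0} ≤ 4 := by
  -- the groups
  have hile : localSubgroup κ.kerSubgroup (v.adicCompletion ℚ) ≤ localSubgroup (κ.layerSubgroup n) (v.adicCompletion ℚ) :=
    fun τ hτ ↦ by
      rw [mem_localSubgroup_iff] at hτ ⊢
      exact κ.kerSubgroup_le_layerSubgroup n hτ
  -- S0: multiplicative reduction at the place `v`
  haveI hfact : Fact (Nat.Prime (primesEquiv v : ℕ)) := ⟨(primesEquiv v).2⟩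
  have hp2 : ((primesEquiv v : Nat.Primes) : ℕ) = 2 := primesEquiv_eq_of_natCast_mem v Nat.prime_two hv
  have hmultv : W.HasMultiplicativeReductionAt v :=
    (hasMultiplicativeReductionAtPrime_iff_hasMultiplicativeReductionAt_ringOfIntegers (W := W) v).mp
      ((KatoHalfPinch.hasMultiplicativeReductionAtPrime_congr W hp2).mpr hmult)
  -- Tate's twisted uniformisation at `v`
  obtain ⟨q, t, Ψ, hq0, hqv, -, -, ht0, ht2, hsurj, hker, hequiv⟩ :=
    TateCurve.exists_twistedTateUniformisation_tateJ W v hmultv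
  set Q : AlgebraicClosure (v.adicCompletion ℚ) :=
    algebraMap (v.adicCompletion ℚ) (AlgebraicClosure (v.adicCompletion ℚ)) q with hQ
  have hQ0 : Q ≠ 0 := by rw [hQ]; exact (map_ne_zero _).mpr hq0
  have hQfix : ∀ σ : absoluteGaloisGroup (v.adicCompletion ℚ), σ • Q = Q := fun σ ↦
    AlgEquiv.commutes (absoluteGaloisGroup.toAlgEquiv _ σ) q
  have hQtor : ∀ j : ℤ, Q ^ j = 1 → j = 0 := by
    intro j hj
    have hj' : q ^ j = 1 := by
      apply (algebraMap (v.adicCompletion ℚ) (AlgebraicClosure (v.adicCompletion ℚ))).injective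
      rw [map_zpow₀, map_one]; exact hj
    have hq1 : ‖q‖ < 1 := Valued.toNormedField.norm_lt_one_iff.mpr hqv
    have hpow : ∀ m : ℕ, q ^ m = 1 → m = 0 := fun m hm ↦ by
      by_contra hm0
      have h1 : ‖q‖ ^ m < 1 := pow_lt_one₀ (norm_nonneg q) hq1 hm0
      rw [← norm_pow, hm, norm_one] at h1
      exact lt_irrefl _ h1
    cases j with
    | ofNat m =>
      rw [Int.ofNat_eq_natCast, zpow_natCast] at hj'
      rw [Int.ofNat_eq_natCast, hpow m hj']
      rfl
    | negSucc m =>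
      rw [zpow_negSucc, inv_eq_one] at hj'
      exact absurd (hpow (m + 1) hj') (Nat.succ_ne_zero m)
  -- `σ t = ± t`, `-t ≠ t`
  have ht : ∀ σ : absoluteGaloisGroup (v.adicCompletion ℚ), σ • t = t ∨ σ • t = -t := fun σ ↦ by
    apply sq_eq_sq_iff_eq_or_eq_neg.mp
    rw [← smul_pow', ht2]
    exact AlgEquiv.commutes (absoluteGaloisGroup.toAlgEquiv _ σ) _
  have hne : -t ≠ t := neg_ne_self_of_ne_zero v ht0
  -- equivariance in value form
  have hequiv' : ∀ (σ : absoluteGaloisGroup (v.adicCompletion ℚ)) (w w' : (AlgebraicClosure (v.adicCompletion ℚ))ˣ),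
      (w' : AlgebraicClosure (v.adicCompletion ℚ)) = σ • (w : AlgebraicClosure (v.adicCompletion ℚ)) →
        σ • Ψ (Additive.ofMul w) = (if σ • t = t then (1 : ℤ) else -1) • Ψ (Additive.ofMul w') := by
    intro σ w w' h
    have hw' : w' = Units.map (absoluteGaloisGroup.toAlgEquiv (v.adicCompletion ℚ) σ :
        AlgebraicClosure (v.adicCompletion ℚ) →* AlgebraicClosure (v.adicCompletion ℚ)) w := Units.ext h
    rw [hw']
    exact hequiv σ w
  -- the flip `τ₀ ∈ H_∞` (BRICK 10)
  obtain ⟨τ₀, hτ₀, hτ₀t⟩ :=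
    exists_mem_localSubgroup_kerSubgroup_smul_sqrt_gamma_eq_neg W hκ hmult hns v hv t ht2
  -- a topological generator `g ∈ H_n` of `H_n` modulo `H_∞` FIXING `t`
  obtain ⟨g, hgn, hgen, hgt⟩ : ∃ g ∈ localSubgroup (κ.layerSubgroup n) (v.adicCompletion ℚ),
      (∀ U : Subgroup (absoluteGaloisGroup (v.adicCompletion ℚ)),
        IsOpen (U : Set (absoluteGaloisGroup (v.adicCompletion ℚ))) →
          localSubgroup κ.kerSubgroup (v.adicCompletion ℚ) ≤ U → g ∈ U →
            localSubgroup (κ.layerSubgroup n) (v.adicCompletion ℚ) ≤ U) ∧ g • t = t := by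
    obtain ⟨g₀, hg₀, hg₀gen⟩ := ZpExtension.exists_mem_localSubgroup_generate κ (v.adicCompletion ℚ) n
    rcases ht g₀ with h | h
    · exact ⟨g₀, hg₀, hg₀gen, h⟩
    · refine ⟨g₀ * τ₀, Subgroup.mul_mem _ hg₀ (hile hτ₀), fun U hU hiU hgU ↦ hg₀gen U hU hiU ?_, ?_⟩
      · have h1 := U.mul_mem hgU (U.inv_mem (hiU hτ₀))
        rwa [mul_inv_cancel_right] at h1
      · rw [mul_smul, hτ₀t, smul_neg, h, neg_neg]
  -- `κ(res g) = 2^n · unit` (BRICK 15)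
  obtain ⟨ug, hug⟩ := exists_units_kappa_resGal_eq_of_generate hκ v hv n hgn hgen
  -- the quadratic class field input (BRICK 17)
  have hN2 := fun (c₁ c₂ c₃ : AlgebraicClosure (v.adicCompletion ℚ)) (h1 : c₁ ≠ 0) (h2 : c₂ ≠ 0) (h3 : c₃ ≠ 0)
      (hc₁ : ∀ h ∈ localSubgroup (κ.layerSubgroup n) (v.adicCompletion ℚ), h • c₁ = c₁)
      (hc₂ : ∀ h ∈ localSubgroup (κ.layerSubgroup n) (v.adicCompletion ℚ), h • c₂ = c₂)
      (hc₃ : ∀ h ∈ localSubgroup (κ.layerSubgroup n) (v.adicCompletion ℚ), h • c₃ = c₃) ↦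
    exists_norm_rel_of_three hκ v hv n ht ht0 (hile hτ₀) hτ₀t c₁ c₂ c₃ h1 h2 h3 hc₁ hc₂ hc₃
  -- the coinvariants `M_∞/(g-1)M_∞`
  set P := localPoints W (v.adicCompletion ℚ) with hP
  set M : AddSubgroup P :=
    FixedPoints.addSubgroup (localSubgroup κ.kerSubgroup (v.adicCompletion ℚ)) P with hM
  have memM : ∀ {a : P}, a ∈ M ↔ ∀ h ∈ localSubgroup κ.kerSubgroup (v.adicCompletion ℚ), h • a = a := fun {a} ↦ by
    rw [hM, FixedPoints.mem_addSubgroup]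
    exact ⟨fun H h hh ↦ H ⟨h, hh⟩, fun H h ↦ H h h.2⟩
  set d : M →+ M := subOne (localSubgroup κ.kerSubgroup (v.adicCompletion ℚ)) P g with hd
  -- every `2^k`-torsion class has a representative `Ψ x`, `x ∈ T`, with `x^{2^k} = Q^j · gz/z`, `z ∈ T`
  have hrep : ∀ y : {y : M ⧸ d.range // 2 ^ k • y = 0},
      ∃ (x z : (AlgebraicClosure (v.adicCompletion ℚ))ˣ) (a j jz : ℤ) (m : M),
        (m : M ⧸ d.range) = y.1 ∧ (m : P) = Ψ (Additive.ofMul x) ∧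
        (∀ h ∈ localSubgroup κ.kerSubgroup (v.adicCompletion ℚ), h • t = t →
          h • (x : AlgebraicClosure (v.adicCompletion ℚ)) = x) ∧
        τ₀ • (x : AlgebraicClosure (v.adicCompletion ℚ)) * x = Q ^ a ∧
        (∀ h ∈ localSubgroup κ.kerSubgroup (v.adicCompletion ℚ), h • t = t →
          h • (z : AlgebraicClosure (v.adicCompletion ℚ)) = z) ∧
        τ₀ • (z : AlgebraicClosure (v.adicCompletion ℚ)) * z = Q ^ jz ∧
        (x : AlgebraicClosure (v.adicCompletion ℚ)) ^ 2 ^ k =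
          Q ^ j * (g • (z : AlgebraicClosure (v.adicCompletion ℚ)) / z) := by
    rintro ⟨y, hy⟩
    obtain ⟨m, rfl⟩ := QuotientAddGroup.mk_surjective y
    obtain ⟨x, hxm, hxL, a, hxa⟩ := exists_unit_of_mem_fixedPoints (κ := κ) v hsurj hker hequiv' hQfix hQ0 hQtor hne
      hτ₀ hτ₀t (memM.mp m.2)
    -- `2^k m ∈ (g-1) M_∞`
    have h2m : (2 ^ k • m : M) ∈ d.range := by
      rw [← QuotientAddGroup.eq_zero_iff]
      exact hy
    obtain ⟨w, hw⟩ := h2m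
    obtain ⟨z, hzm, hzL, jz, hzj⟩ := exists_unit_of_mem_fixedPoints (κ := κ) v hsurj hker hequiv' hQfix hQ0 hQtor hne
      hτ₀ hτ₀t (memM.mp w.2)
    -- `Ψ (x^{2^k}) = Ψ (gz / z)`
    set gz : (AlgebraicClosure (v.adicCompletion ℚ))ˣ :=
      Units.mk0 (g • (z : AlgebraicClosure (v.adicCompletion ℚ))) ((smul_ne_zero_iff_ne g).mpr z.ne_zero) with hgz
    have hgΨ : g • Ψ (Additive.ofMul z) = Ψ (Additive.ofMul gz) := by
      have h1 := hequiv' g z gz rfl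
      rw [if_pos hgt, one_zsmul] at h1
      exact h1
    have h3 : Ψ (Additive.ofMul (x ^ 2 ^ k)) = Ψ (Additive.ofMul (gz * z⁻¹)) := by
      rw [ofMul_pow, map_nsmul, hxm, ofMul_mul, ofMul_inv, map_add, map_neg, ← hgΨ, hzm, ← sub_eq_add_neg]
      have h4 := congrArg (fun b : M ↦ (b : P)) hw
      simp only [hd, AddSubgroupClass.coe_nsmul] at h4
      exact h4.symm
    rw [tatePsi_eq_iff v hker] at h3
    obtain ⟨j, hj⟩ := h3
    refine ⟨x, z, a, j, jz, m, rfl, hxm.symm, hxL, hxa, hzL, hzj, ?_⟩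
    rw [Units.val_pow_eq_pow_val] at hj
    rw [hj, Units.val_mul, Units.val_inv_eq_inv_val, hgz, Units.val_mk0, div_eq_mul_inv]
  choose x z a j jz m hmy hmx hxL hxa hzL hzj hxk using hrep
  -- among five `2^k`-torsion classes two coincide
  have key5 : ∀ ys : Fin 5 → {y : M ⧸ d.range // 2 ^ k • y = 0}, ∃ i i' : Fin 5, i ≠ i' ∧ ys i = ys i' := by
    intro ys
    obtain ⟨i, i', hii', cc, w, hw0, hwL, ⟨jw, hwj⟩, hrel⟩ :=
      exists_div_eq_zpow_mul_coboundary_of_five_pow (κ := κ) v n hug hgn ht hgt hτ₀ hτ₀t hQfix hQ0 hQtor hN2 k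
        (x := fun i ↦ (x (ys i) : AlgebraicClosure (v.adicCompletion ℚ)))
        (z := fun i ↦ (z (ys i) : AlgebraicClosure (v.adicCompletion ℚ)))
        (a := fun i ↦ a (ys i)) (j := fun i ↦ j (ys i)) (jz := fun i ↦ jz (ys i))
        (fun i ↦ (x (ys i)).ne_zero) (fun i ↦ hxL (ys i)) (fun i ↦ hxa (ys i)) (fun i ↦ (z (ys i)).ne_zero)
        (fun i ↦ hzL (ys i)) (fun i ↦ hzj (ys i)) (fun i ↦ hxk (ys i))
    refine ⟨i, i', hii', ?_⟩
    -- `Ψ (x i) - Ψ (x i') = (g - 1) Ψ(w)` with `Ψ w ∈ M_∞`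
    set wu : (AlgebraicClosure (v.adicCompletion ℚ))ˣ := Units.mk0 w hw0 with hwu
    have hwM : Ψ (Additive.ofMul wu) ∈ M :=
      memM.mpr (apply_mem_fixedPoints (κ := κ) v hker hequiv' ht hne hτ₀ hτ₀t (x := wu)
        (fun h hh hht ↦ by rw [hwu, Units.val_mk0]; exact hwL h hh hht) (a := jw) (by rw [hwu, Units.val_mk0]; exact hwj))
    set gw : (AlgebraicClosure (v.adicCompletion ℚ))ˣ :=
      Units.mk0 (g • w) ((smul_ne_zero_iff_ne g).mpr hw0) with hgw
    have hgΨ : g • Ψ (Additive.ofMul wu) = Ψ (Additive.ofMul gw) := by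
      have h1 := hequiv' g wu gw (by rw [hgw, hwu, Units.val_mk0, Units.val_mk0])
      rw [if_pos hgt, one_zsmul] at h1
      exact h1
    have hdP : (d ⟨Ψ (Additive.ofMul wu), hwM⟩ : P) = g • Ψ (Additive.ofMul wu) - Ψ (Additive.ofMul wu) := rfl
    have hdiff : Ψ (Additive.ofMul (x (ys i))) - Ψ (Additive.ofMul (x (ys i'))) =
        (d ⟨Ψ (Additive.ofMul wu), hwM⟩ : P) := by
      rw [hdP, hgΨ]
      have e1 : Ψ (Additive.ofMul (x (ys i))) - Ψ (Additive.ofMul (x (ys i'))) =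
          Ψ (Additive.ofMul (x (ys i) * (x (ys i'))⁻¹)) := by
        rw [ofMul_mul, ofMul_inv, map_add, map_neg, sub_eq_add_neg]
      have e2 : Ψ (Additive.ofMul gw) - Ψ (Additive.ofMul wu) = Ψ (Additive.ofMul (gw * wu⁻¹)) := by
        rw [ofMul_mul, ofMul_inv, map_add, map_neg, sub_eq_add_neg]
      rw [e1, e2, tatePsi_eq_iff v hker]
      refine ⟨cc, ?_⟩
      rw [Units.val_mul, Units.val_inv_eq_inv_val, Units.val_mul, Units.val_inv_eq_inv_val, hgw, hwu, Units.val_mk0,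
        Units.val_mk0, ← div_eq_mul_inv, hrel, div_eq_mul_inv]
    have hmm : (m (ys i) : M ⧸ d.range) = m (ys i') := by
      rw [QuotientAddGroup.eq_iff_sub_mem]
      refine ⟨⟨Ψ (Additive.ofMul wu), hwM⟩, Subtype.ext ?_⟩
      rw [AddSubgroupClass.coe_sub, hmx, hmx]
      exact hdiff.symm
    exact Subtype.ext (by rw [← hmy (ys i), ← hmy (ys i'), hmm])
  -- hence the `2^k`-torsion of the coinvariants is finite of order `≤ 4`
  haveI hfin : Finite {y : M ⧸ d.range // 2 ^ k • y = 0} := by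
    by_contra hinf
    rw [not_finite_iff_infinite] at hinf
    let emb := Infinite.natEmbedding {y : M ⧸ d.range // 2 ^ k • y = 0}
    obtain ⟨i, i', hii', h⟩ := key5 (fun i : Fin 5 ↦ emb i)
    exact hii' (Fin.ext (emb.injective h))
  have hcard : Nat.card {y : M ⧸ d.range // 2 ^ k • y = 0} ≤ 4 := by
    by_contra hlt
    push Not at hlt
    letI := Fintype.ofFinite {y : M ⧸ d.range // 2 ^ k • y = 0}
    rw [Nat.card_eq_fintype_card] at hlt
    let emb : Fin 5 ↪ {y : M ⧸ d.range // 2 ^ k • y = 0} :=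
      (Fin.castLEEmb hlt).trans (Fintype.equivFin _).symm.toEmbedding
    obtain ⟨i, i', hii', h⟩ := key5 emb
    exact hii' (emb.injective h)
  -- BRICK 11 at `m = 2^k`
  have h11 := finite_torsionBy_localTowerKerPrimary_and_card_le W κ (v.adicCompletion ℚ) n hgn hgen (2 ^ k)
  exact ⟨h11.1, h11.2.trans hcard⟩

/-! ### `2`-primary exhaustion: from the `2^k`-torsion bounds to the ORDER bound -/

/-- **A `p`-primary group all of whose `p^k`-torsion subgroups have at most `C` elements has at most `C` elements** (and is
finite): any `C + 1` elements are killed by a common power `p^K`. [folklore] -/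
theorem finite_and_natCard_le_of_forall_torsionBy_pow {G : Type*} [AddCommGroup G] (p C : ℕ)
    (htor : ∀ x : G, ∃ k : ℕ, p ^ k • x = 0)
    (hk : ∀ k : ℕ, Finite {x : G // p ^ k • x = 0} ∧ Nat.card {x : G // p ^ k • x = 0} ≤ C) :
    Finite G ∧ Nat.card G ≤ C := by
  -- no injective family of `C + 1` elements
  have key : ∀ f : Fin (C + 1) → G, ¬ Function.Injective f := by
    intro f hf
    choose kf hkf using fun i ↦ htor (f i)
    set K : ℕ := ∑ i, kf i with hK
    have hKf : ∀ i, p ^ K • f i = 0 := fun i ↦ by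
      have hle : kf i ≤ K := by
        rw [hK]
        exact Finset.single_le_sum (f := kf) (fun j _ ↦ Nat.zero_le _) (Finset.mem_univ i)
      obtain ⟨e, he⟩ := Nat.exists_eq_add_of_le hle
      rw [he, pow_add, mul_comm, mul_smul, hkf, smul_zero]
    obtain ⟨hfinK, hcardK⟩ := hk K
    let f' : Fin (C + 1) → {x : G // p ^ K • x = 0} := fun i ↦ ⟨f i, hKf i⟩
    have hf' : Function.Injective f' := fun i i' h ↦ hf (congrArg Subtype.val h)
    have hle := Nat.card_le_card_of_injective f' hf'
    rw [Nat.card_eq_fintype_card, Fintype.card_fin] at hle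
    omega
  haveI hfin : Finite G := by
    by_contra hinf
    rw [not_finite_iff_infinite] at hinf
    let emb := Infinite.natEmbedding G
    exact key (fun i : Fin (C + 1) ↦ emb i) fun i i' h ↦ Fin.ext (emb.injective h)
  refine ⟨hfin, ?_⟩
  by_contra hlt
  push Not at hlt
  letI := Fintype.ofFinite G
  rw [Nat.card_eq_fintype_card] at hlt
  let emb : Fin (C + 1) ↪ G := (Fin.castLEEmb hlt).trans (Fintype.equivFin _).symm.toEmbedding
  exact key emb emb.injective

/-- **`𝒦_{v,n}[2^∞]` is FINITE OF ORDER `≤ 4` at EVERY non-split multiplicative `2`, every layer — KERNEL theorem.** For a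
globally minimal `W/ℚ`, multiplicative and NON-SPLIT at `2`, every cyclotomic `ℤ₂`-datum `κ`, the place `v ∋ 2` and every
layer `n`: `Finite (W.localTowerKerPrimary κ ℚ_v n)` and `Nat.card ≤ 4`. This is Greenberg's `|ker(r_{v_n})| ∼ 2c_v ≤ 4`
(LNM 1716 p. 93) over `ℚ` — the `2^k`-torsion bounds `powTorsion_localTowerKerPrimary_le_four_nonsplitTwo` for every `k`
and `2`-primary exhaustion (`𝒦_{v,n}[2^∞]` is `2`-primary by definition). [cite: GreenbergLNM1716, §3 (pp. 85–93)]
[cite: SilvermanATAEC1994, Thm. V.5.3, Lemma V.5.2 (c)] [cite: NeukirchANT1999, Ch. V §1 Thm. (1.1)] -/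
theorem finite_and_natCard_localTowerKerPrimary_le_four_nonsplitTwo (W : WeierstrassCurve ℚ) [W.IsElliptic]
    [W.IsGloballyMinimal] (hmult : W.HasMultiplicativeReductionAtPrime 2)
    (hns : ¬ W.HasSplitMultiplicativeReductionAtPrime 2) (hκ : κ.IsCyclotomic) (v : HeightOneSpectrum (𝓞 ℚ))
    (hv : ((2 : ℕ) : 𝓞 ℚ) ∈ v.asIdeal) (n : ℕ) :
    Finite (W.localTowerKerPrimary κ (v.adicCompletion ℚ) n) ∧
      Nat.card (W.localTowerKerPrimary κ (v.adicCompletion ℚ) n) ≤ 4 := by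
  refine finite_and_natCard_le_of_forall_torsionBy_pow 2 4 (fun x ↦ ?_)
    (fun k ↦ powTorsion_localTowerKerPrimary_le_four_nonsplitTwo W hmult hns hκ v hv n k)
  obtain ⟨-, k, hk⟩ := (W.mem_localTowerKerPrimary_iff κ (v.adicCompletion ℚ) n x.1).mp x.2
  exact ⟨k, Subtype.ext (by rw [AddSubgroupClass.coe_nsmul, hk]; rfl)⟩

/-! ### The named fact `hNS2`, PROVED -/

/-- **Greenberg, LNM 1716 (1999), §3, PDF p. 93 — NON-SPLIT multiplicative `v ∣ 2`, every layer, case `F = ℚ`: the named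
fact `sec3_natCard_localTowerKerPrimary_le_four_nonsplitMultiplicative_two` (PRINT binder `hNS2` of the NON-SPLIT tower doors
of item 19922) HOLDS** — for every globally minimal `W/ℚ` multiplicative but not split multiplicative at `2`, every
cyclotomic `ℤ₂`-extension `κ`, the place `v ∋ 2` and every `n`, `𝒦_{v,n}[2^∞] = ker(r_{v_n})` is finite of order `≤ 4`
("`|ker(r_v)| ∼ 2c_v`", `c_v ∈ {1, 2}`). Signature verbatim; by
`MultTowerNS2.finite_and_natCard_localTowerKerPrimary_le_four_nonsplitTwo` (twisted Tate module over the local cyclotomic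
`ℤ₂`-tower, cyclic Hilbert 90, the class field axiom for the unramified quadratic layer — all kernel theorems). Consumers keep
the hypothesis `(hNS2 : …)` and may pass this term; nothing is re-keyed here. BSD is not proved by this.
[cite: GreenbergLNM1716, §3, between Prop. 3.6 and Prop. 3.7 (PDF p. 93)] [cite: SilvermanAEC2009, C.15 Table 15.1 and VII.5.4] -/
theorem sec3_natCard_localTowerKerPrimary_le_four_nonsplitMultiplicative_two_holds :
    Greenberg1999.sec3_natCard_localTowerKerPrimary_le_four_nonsplitMultiplicative_two :=
  fun W _ _ hmult hns _κ hκ v hv n ↦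
    finite_and_natCard_localTowerKerPrimary_le_four_nonsplitTwo W hmult hns hκ v hv n

end Summit.BirchSwinnertonDyer.BirchSwinnertonDyer.Theorems.MultTowerNS2

end
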